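import Literature.NumberTheory.GaloisRepresentations.LocalField
import Mathlib.NumberTheory.Padics.ProperSpace
import Mathlib.NumberTheory.Padics.RingHoms
import HarnessLib

/-!
# `ℚ_[p]` is a (non-archimedean) local field (proofs)

Sibling *proofs* file (theorems only: no definition, no named fact, no instance) of
`Literature.NumberTheory.GaloisRepresentations.LocalField`, discharging the two named facts stated
there for `ℚ_[p]` (outline GalRep D4: theorems, never instances):

* `Padic.isNonarchimedeanLocalField` — `ℚ_[p]` with Mathlib's valuative relation
  `Padic.instValuativeRel` (that of `Padic.mulValuation`) and its metric topology is a
  non-archimedean local field in Mathlib's sense (`IsNonarchimedeanLocalField`: valuative topology,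
  locally compact, non-trivially valued);
* `Padic.isLocalField` — hence a local field in Weil's sense
  (`IsNonarchimedeanLocalField.isLocalField`, proved in `LocalField.lean`).

Appended (2026-08-15, theorems only): the **valuation ring, residue field and uniformiser of
`ℚ_[p]`** for this local field structure — `𝒪[ℚ_[p]] = {‖x‖ ≤ 1}` is Mathlib's `ℤ_[p]`
(`mem_valuationInteger_iff`, `nonempty_valuationInteger_ringEquiv_padicInt`), hence
`residueFieldCard ℚ_[p] = p` (`residueFieldCard_eq`, via Mathlib `PadicInt.residueField`) and `p`
is a uniformiser, `Irreducible (p : 𝒪[ℚ_[p]])` (`irreducible_natCast_valuationInteger`, via Mathlib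
`PadicInt.irreducible_p`), `p ∈ 𝓂[ℚ_[p]]` (`natCast_mem_maximalIdeal`) — the two numerical inputs
(`residueFieldCard_eq`, `irreducible_natCast`) of a `LocalRestrictionAt p ρ̄` datum
(`SerreWeight.lean`) built on `ℚ_[p]` itself rather than on `v.adicCompletion ℚ`.

Mathlib (at the pin) supplies `ValuativeRel ℚ_[p]`, `ValuativeRel.IsNontrivial ℚ_[p]`
(`NumberTheory/Padics/ValuativeRel.lean`) and `ProperSpace ℚ_[p]` (`NumberTheory/Padics/ProperSpace.lean`:
`ℤ_[p]` is compact, so `ℚ_[p]` is locally compact), but no `IsValuativeTopology ℚ_[p]`: the one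
thing proved here is that **the metric topology of `ℚ_[p]` is the valuative topology**
(`Padic.isValuativeTopology`), i.e. the balls `{‖x‖ < ε}` and the sets `{v x < γ}` are cofinal in
each other at `0` — because `‖x‖ = p ^ {log v(x)}` is a strictly increasing function of the
valuation (`Padic.norm_lt_norm_iff_mulValuation_lt`) and `‖pⁿ‖ = p⁻ⁿ → 0`. Serre, *Local Fields*
(1979), Ch. II §1 (`ℚ_p` is complete with finite residue field, hence locally compact, Prop. 1);
Gouvêa, *p-adic Numbers*, §3.3; Weil, *Basic Number Theory* (1967), Ch. I §3.

## References

* [SerreLocalFields1979] J.-P. Serre, *Local Fields*, GTM 67 (1979): Ch. II §1, Prop. 1.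
* [Weil1967] A. Weil, *Basic Number Theory* (1967): Ch. I §3.
-/

noncomputable section

open ValuativeRel Filter Topology Set

namespace Literature.NumberTheory.GaloisRepresentations

namespace Padic

variable (p : ℕ) [hp : Fact p.Prime]

/-- On `ℚ_[p]`, `‖x‖ < ‖y‖ ↔ v(x) < v(y)` for Mathlib's `ℤᵐ⁰`-valued `Padic.mulValuation`
(`‖x‖ = p ^ {log v(x)}` for `x ≠ 0`, `Padic.norm_eq_zpow_log_mulValuation`, and `t ↦ p ^ t` is
strictly increasing). [folklore] -/
theorem norm_lt_norm_iff_mulValuation_lt (x y : ℚ_[p]) :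
    ‖x‖ < ‖y‖ ↔ _root_.Padic.mulValuation x < _root_.Padic.mulValuation y := by
  by_cases hy : y = 0
  · subst hy
    simp only [norm_zero, map_zero]
    exact ⟨fun h ↦ (h.not_ge (norm_nonneg x)).elim, fun h ↦ (not_lt_zero h).elim⟩
  by_cases hx : x = 0
  · subst hx
    simp only [norm_zero, map_zero, norm_pos_iff, ne_eq, hy, not_false_eq_true, true_iff]
    exact zero_lt_iff.mpr ((Valuation.ne_zero_iff _).mpr hy)
  have hp1 : (1 : ℝ) < p := by exact_mod_cast hp.out.one_lt
  rw [_root_.Padic.norm_eq_zpow_log_mulValuation hx, _root_.Padic.norm_eq_zpow_log_mulValuation hy,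
    zpow_lt_zpow_iff_right₀ hp1,
    WithZero.log_lt_log ((Valuation.ne_zero_iff _).mpr hx) ((Valuation.ne_zero_iff _).mpr hy)]

/-- **The metric topology of `ℚ_[p]` is the valuative topology** of Mathlib's valuative relation
`Padic.instValuativeRel` (the one induced by `Padic.mulValuation`): a set is a neighbourhood of
`0` iff it contains some `{x | v x < γ}`, `γ` a unit of the value group. The sets `{v x < v a}`,
`a ≠ 0`, are the open balls `{‖x‖ < ‖a‖}` (`norm_lt_norm_iff_mulValuation_lt` and compatibility
of `v` with `mulValuation`), every unit `γ` is a value `v a` (`valuation_surjective`), and the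
balls `{‖x‖ < ‖pⁿ‖ = p⁻ⁿ}` are cofinal (`PadicInt.exists_pow_neg_lt`). A theorem, not an
instance (outline GalRep D4). Serre, *Local Fields*, Ch. II §1; Gouvêa, *p-adic Numbers*, §3.3.
[cite: SerreLocalFields1979, Ch. II §1] -/
theorem isValuativeTopology : IsValuativeTopology ℚ_[p] := by
  refine IsValuativeTopology.of_zero fun s ↦ ?_
  rw [Metric.nhds_basis_ball.mem_iff]
  constructor
  · rintro ⟨ε, hε, hsub⟩
    obtain ⟨k, hk⟩ := PadicInt.exists_pow_neg_lt p hε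
    set a : ℚ_[p] := (p : ℚ_[p]) ^ (k : ℤ) with ha_def
    have ha : ‖a‖ = (p : ℝ) ^ (-(k : ℤ)) := by
      rw [ha_def, _root_.Padic.norm_p_zpow]
    have hp0 : (p : ℚ_[p]) ≠ 0 := by exact_mod_cast hp.out.ne_zero
    have ha0 : a ≠ 0 := zpow_ne_zero _ hp0
    have hva : valuation ℚ_[p] a ≠ 0 := by simpa using ha0
    refine ⟨Units.mk0 _ hva, fun x hx ↦ hsub ?_⟩
    have hx' : x <ᵥ a := (Valuation.vlt_iff_lt (valuation ℚ_[p])).mpr hx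
    have hlt : _root_.Padic.mulValuation x < _root_.Padic.mulValuation a :=
      (Valuation.vlt_iff_lt _root_.Padic.mulValuation).mp hx'
    rw [mem_ball_zero_iff]
    calc ‖x‖ < ‖a‖ := (norm_lt_norm_iff_mulValuation_lt p x a).mpr hlt
      _ = (p : ℝ) ^ (-(k : ℤ)) := ha
      _ < ε := hk
  · rintro ⟨γ, hγ⟩
    obtain ⟨a, ha⟩ := valuation_surjective (γ : ValueGroupWithZero ℚ_[p])
    have ha0 : a ≠ 0 := by
      rintro rfl
      exact γ.ne_zero (by simpa using ha.symm)
    refine ⟨‖a‖, norm_pos_iff.mpr ha0, fun x hx ↦ hγ ?_⟩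
    rw [mem_ball_zero_iff] at hx
    have hlt : _root_.Padic.mulValuation x < _root_.Padic.mulValuation a :=
      (norm_lt_norm_iff_mulValuation_lt p x a).mp hx
    have hx' : x <ᵥ a := (Valuation.vlt_iff_lt _root_.Padic.mulValuation).mpr hlt
    show valuation ℚ_[p] x < γ
    rw [← ha]
    exact (Valuation.vlt_iff_lt (valuation ℚ_[p])).mp hx'

/-- **Discharge of the named fact `Padic.isNonarchimedeanLocalField`** (`LocalField.lean`): for
every prime `p`, `ℚ_[p]` is a non-archimedean local field in Mathlib's sense — valuative topology
(`isValuativeTopology`), locally compact (Mathlib `Padic.instProperSpace`: `ℤ_[p]` is compact) and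
non-trivially valued (Mathlib, `v p < 1`). Serre, *Local Fields*, Ch. II §1 (Prop. 1: complete,
discretely valued with finite residue field ⇒ locally compact); Weil 1967, Ch. I §3.
[cite: SerreLocalFields1979, Ch. II §1] -/
theorem isNonarchimedeanLocalField_holds : isNonarchimedeanLocalField := by
  intro p _
  haveI := isValuativeTopology p
  exact {}

/-- **Discharge of the named fact `Padic.isLocalField`** (`LocalField.lean`): `ℚ_[p]` is a local
field in Weil's sense (Hausdorff, locally compact, non-discrete topological field), as is every
non-archimedean local field (`IsNonarchimedeanLocalField.isLocalField`). Weil, *Basic Number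
Theory* (1967), Ch. I §3. [cite: Weil1967, Ch. I §3] -/
theorem isLocalField_holds : isLocalField := by
  intro p _
  haveI := isValuativeTopology p
  haveI : IsNonarchimedeanLocalField ℚ_[p] := {}
  exact IsNonarchimedeanLocalField.isLocalField ℚ_[p]

/-! ### Valuation ring, residue field and uniformiser of `ℚ_[p]` -/

/-- On `ℚ_[p]`, `‖x‖ ≤ 1 ↔ v(x) ≤ 1` for Mathlib's `ℤᵐ⁰`-valued `Padic.mulValuation`
(from `norm_lt_norm_iff_mulValuation_lt` with `y = 1`). [folklore] -/
theorem norm_le_one_iff_mulValuation_le_one (x : ℚ_[p]) :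
    ‖x‖ ≤ 1 ↔ _root_.Padic.mulValuation x ≤ 1 := by
  have h := norm_lt_norm_iff_mulValuation_lt p 1 x
  rw [norm_one, map_one] at h
  rw [← not_lt, h, not_lt]

/-- The valuation ring `𝒪[ℚ_[p]]` of Mathlib's valuative relation on `ℚ_[p]`
(`Padic.instValuativeRel`, that of `Padic.mulValuation`) is the closed unit ball `{‖x‖ ≤ 1}`,
i.e. the carrier of `ℤ_[p]` (Serre, *Local Fields*, Ch. II §1; Gouvêa, *p-adic Numbers*, §3.3).
[folklore] -/
theorem mem_valuationInteger_iff (x : ℚ_[p]) : x ∈ 𝒪[ℚ_[p]] ↔ ‖x‖ ≤ 1 := by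
  rw [Valuation.mem_integer_iff, ← Valuation.vle_one_iff (valuation ℚ_[p]),
    Valuation.vle_one_iff _root_.Padic.mulValuation, norm_le_one_iff_mulValuation_le_one]

/-- `𝒪[ℚ_[p]] ≃+* ℤ_[p]`: the valuation ring of `ℚ_[p]` *is* Mathlib's ring of `p`-adic integers
(both are the subring `{‖x‖ ≤ 1}` of `ℚ_[p]`, `mem_valuationInteger_iff`; the isomorphism is the
identity on `ℚ_[p]`).  Stated as `Nonempty`, this proofs file declaring no data.
Ref: Serre, *Local Fields*, Ch. II §1. [folklore] -/
theorem nonempty_valuationInteger_ringEquiv_padicInt : Nonempty (𝒪[ℚ_[p]] ≃+* ℤ_[p]) :=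
  ⟨{ toFun := fun x => ⟨x.1, (mem_valuationInteger_iff p x.1).mp x.2⟩
     invFun := fun y => ⟨y.1, (mem_valuationInteger_iff p y.1).mpr y.2⟩
     left_inv := fun _ => rfl
     right_inv := fun _ => rfl
     map_mul' := fun _ _ => rfl
     map_add' := fun _ _ => rfl }⟩

/-- **The residue field of `ℚ_p` has `p` elements**: `residueFieldCard ℚ_[p] = p` for the local
field structure `isNonarchimedeanLocalField_holds p` (`𝒪[ℚ_[p]] ≃+* ℤ_[p]` and Mathlib's
`PadicInt.residueField : ResidueField ℤ_[p] ≃+* ZMod p`).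
Ref: Serre, *Local Fields*, Ch. II §1 (example: `ℚ_p`, residue field `𝔽_p`). [folklore] -/
theorem residueFieldCard_eq :
    haveI := isNonarchimedeanLocalField_holds p
    IsNonarchimedeanLocalField.residueFieldCard ℚ_[p] = p := by
  obtain ⟨e⟩ := nonempty_valuationInteger_ringEquiv_padicInt p
  show Nat.card (IsLocalRing.ResidueField 𝒪[ℚ_[p]]) = p
  rw [Nat.card_congr ((IsLocalRing.ResidueField.mapEquiv e).trans
    (PadicInt.residueField (p := p))).toEquiv, Nat.card_zmod]

/-- **`p` is a uniformiser of `𝒪[ℚ_[p]]`**: `(p : 𝒪[ℚ_[p]])` is irreducible (transported from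
Mathlib's `PadicInt.irreducible_p` along `𝒪[ℚ_[p]] ≃+* ℤ_[p]`).
Ref: Serre, *Local Fields*, Ch. II §1. [folklore] -/
theorem irreducible_natCast_valuationInteger : Irreducible (p : 𝒪[ℚ_[p]]) := by
  obtain ⟨e⟩ := nonempty_valuationInteger_ringEquiv_padicInt p
  have h := PadicInt.irreducible_p (p := p)
  rw [← map_natCast e] at h
  exact (MulEquiv.irreducible_iff e).mp h

/-- `p ∈ 𝓂[ℚ_[p]]`: the residue characteristic of `ℚ_[p]` is `p` (`v(p) < 1`, Mathlib
`Padic.valuation_p_lt_one`). Ref: Serre, *Local Fields*, Ch. II §1. [folklore] -/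
theorem natCast_mem_maximalIdeal : (p : 𝒪[ℚ_[p]]) ∈ 𝓂[ℚ_[p]] := by
  rw [IsLocalRing.mem_maximalIdeal, mem_nonunits_iff,
    Valuation.Integer.not_isUnit_iff_valuation_lt_one]
  exact _root_.Padic.valuation_p_lt_one (valuation ℚ_[p])

end Padic

end Literature.NumberTheory.GaloisRepresentations
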